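import Summits.CriticalPhenomena.PercolationContinuityZ3.Theorems.PercNearOneGluingNoHeavyLowerTailCILCutObserverSteiner
import HarnessLib

/-!
# `NoHeavyLowerTail` (stmt-CriticalPhenomena-4575) — the cut observer with STEINER ports: CIL corollaries

Support file (prover `prim-hp-5`, technique "blob-quotient induction"; `--supports
stmt-CriticalPhenomena-4575`).  No definitions, no named facts, no sorries.

Corollaries of `CutObserver.SteinerPorts.tform_transfer` (file `…CILCutObserverSteiner`), the transfer of
the T-form `μ{1 ≤ N ≤ j} ≤ μ{1 ≤ N ∧ |π(c)| ≤ j}` through an observer whose neighbourhood splits into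
separated branches attached by single pairs with ports that may be non-relays:

* `tform_port` — one-block transfer through a single Steiner port (`tform_transfer` with one branch);
* `cil_transfer`, `condCil_transfer` — inside `W`: CIL `μ{1 ≤ N ≤ j} ≤ μ{|π(a i)| ≤ j}` and the conditional
  form `μ{1 ≤ N ≤ j} ≤ μ{1 ≤ N}·μ{|π(a i)| ≤ j}` (T-form + Harris);
* `tform_cutObserver_steinerPorts`, `cumulativeIsolation_cutObserver_steinerPorts` — the whole graph
  (`W = univ`): `∃ a ∈ A`, T-form resp. the conclusion of the registered stub `stub_cumulativeIsolation`, for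
  every cut observer with Steiner ports whose live branches satisfy the branch T-form;
* `tform_cutObserver_relayPorts` — relay ports: the branch hypotheses are vacuous, so the cut-observer
  theorem `Theorems.cumulativeIsolation_cutObserver` is upgraded to the guarded (T-) form.

By induction on the Steiner hull these give the T-form, hence CIL, at every observer of a TREE (arbitrary
weights, arbitrary relay/Steiner marking) and more generally of every recursively separated hull (each hull
vertex a cut observer of its sub-branches); the induction over the hull is the caller's (paper proof in the
seat's HOME memo TFORM-TRANSFER.md; numerics 0 / 2 369 random trees).
-/

noncomputable section

namespace Summit.CriticalPhenomena.PercolationContinuityZ3.Theorems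

open MeasureTheory Set Literature.Probability.LatticeModels Literature.Probability.Percolation
open scoped Classical BigOperators

variable {n : ℕ}

namespace CutObserver

namespace SteinerPorts

/-! ### Corollaries -/

/-- **CIL transfer (inside `W`).**  Under the hypotheses of `tform_transfer`, the cumulative isolation
lemma holds at `o` inside `W` with the same witness: `μ{1 ≤ N ≤ j} ≤ μ{|π_W(a i)| ≤ j}`. [folklore] -/
theorem cil_transfer (w : Sym2 (Fin n) → unitInterval) (A W : Finset (Fin n)) (o : Fin n) (j : ℕ)
    {d : ℕ} (V : Fin d → Finset (Fin n)) (p a : Fin d → Fin n) (i : Fin d)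
    (hoA : o ∉ A) (hpV : ∀ l, p l ∈ V l) (haV : ∀ l, a l ∈ V l) (hoV : ∀ l, o ∉ V l)
    (hdisj : ∀ l l', l ≠ l' → Disjoint (V l) (V l'))
    (hoW : o ∈ W) (hVW : ∀ l, V l ⊆ W) (hcover : ∀ v ∈ W, v ≠ o → ∃ l, v ∈ V l)
    (hobs : ∀ l, ∀ v ∈ V l, v ≠ p l → w s(o, v) = 0)
    (hsep : ∀ l l', l ≠ l' → ∀ u ∈ V l, ∀ v ∈ V l', w s(u, v) = 0)
    (hdead : ∀ l, a l ∉ A → ∀ x ∈ V l, x ∉ A)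
    (hT : ∀ l, a l ∈ A →
      (prodBernoulli w).real {ω : BondConfig (Fin n) |
          1 ≤ (A.filter fun x => (openGraph (ω ∩ ↑((V l).sym2))).Reachable (p l) x).card ∧
            (A.filter fun x => (openGraph (ω ∩ ↑((V l).sym2))).Reachable (p l) x).card ≤ j} ≤
        (prodBernoulli w).real {ω : BondConfig (Fin n) |
          1 ≤ (A.filter fun x => (openGraph (ω ∩ ↑((V l).sym2))).Reachable (p l) x).card ∧
            (A.filter fun x => (openGraph (ω ∩ ↑((V l).sym2))).Reachable (a l) x).card ≤ j})
    (hi : a i ∈ A)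
    (himax : ∀ l, a l ∈ A →
      (prodBernoulli w).real {ω : BondConfig (Fin n) |
          (A.filter fun x => (openGraph (ω ∩ ↑((V l).sym2))).Reachable (a l) x).card ≤ j} ≤
        (prodBernoulli w).real {ω : BondConfig (Fin n) |
          (A.filter fun x => (openGraph (ω ∩ ↑((V i).sym2))).Reachable (a i) x).card ≤ j}) :
    (prodBernoulli w).real {ω : BondConfig (Fin n) |
        1 ≤ (A.filter fun x => (openGraph (ω ∩ ↑(W.sym2))).Reachable o x).card ∧
          (A.filter fun x => (openGraph (ω ∩ ↑(W.sym2))).Reachable o x).card ≤ j} ≤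
      (prodBernoulli w).real {ω : BondConfig (Fin n) |
        (A.filter fun x => (openGraph (ω ∩ ↑(W.sym2))).Reachable (a i) x).card ≤ j} := by
  refine le_trans (tform_transfer w A W o j V p a i hoA hpV haV hoV hdisj hoW hVW hcover hobs hsep
    hdead hT hi himax) (measureReal_mono (fun ω hω => hω.2) (measure_ne_top _ _))

/-- **Conditional CIL transfer (inside `W`).**  Under the hypotheses of `tform_transfer`:
`μ{1 ≤ N ≤ j} ≤ μ{1 ≤ N} · μ{|π_W(a i)| ≤ j}` — the T-form followed by Harris' inequality (`{1 ≤ N}` is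
increasing, `{|π(a i)| ≤ j}` decreasing). [folklore] -/
theorem condCil_transfer (w : Sym2 (Fin n) → unitInterval) (A W : Finset (Fin n)) (o : Fin n) (j : ℕ)
    {d : ℕ} (V : Fin d → Finset (Fin n)) (p a : Fin d → Fin n) (i : Fin d)
    (hoA : o ∉ A) (hpV : ∀ l, p l ∈ V l) (haV : ∀ l, a l ∈ V l) (hoV : ∀ l, o ∉ V l)
    (hdisj : ∀ l l', l ≠ l' → Disjoint (V l) (V l'))
    (hoW : o ∈ W) (hVW : ∀ l, V l ⊆ W) (hcover : ∀ v ∈ W, v ≠ o → ∃ l, v ∈ V l)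
    (hobs : ∀ l, ∀ v ∈ V l, v ≠ p l → w s(o, v) = 0)
    (hsep : ∀ l l', l ≠ l' → ∀ u ∈ V l, ∀ v ∈ V l', w s(u, v) = 0)
    (hdead : ∀ l, a l ∉ A → ∀ x ∈ V l, x ∉ A)
    (hT : ∀ l, a l ∈ A →
      (prodBernoulli w).real {ω : BondConfig (Fin n) |
          1 ≤ (A.filter fun x => (openGraph (ω ∩ ↑((V l).sym2))).Reachable (p l) x).card ∧
            (A.filter fun x => (openGraph (ω ∩ ↑((V l).sym2))).Reachable (p l) x).card ≤ j} ≤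
        (prodBernoulli w).real {ω : BondConfig (Fin n) |
          1 ≤ (A.filter fun x => (openGraph (ω ∩ ↑((V l).sym2))).Reachable (p l) x).card ∧
            (A.filter fun x => (openGraph (ω ∩ ↑((V l).sym2))).Reachable (a l) x).card ≤ j})
    (hi : a i ∈ A)
    (himax : ∀ l, a l ∈ A →
      (prodBernoulli w).real {ω : BondConfig (Fin n) |
          (A.filter fun x => (openGraph (ω ∩ ↑((V l).sym2))).Reachable (a l) x).card ≤ j} ≤
        (prodBernoulli w).real {ω : BondConfig (Fin n) |
          (A.filter fun x => (openGraph (ω ∩ ↑((V i).sym2))).Reachable (a i) x).card ≤ j}) :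
    (prodBernoulli w).real {ω : BondConfig (Fin n) |
        1 ≤ (A.filter fun x => (openGraph (ω ∩ ↑(W.sym2))).Reachable o x).card ∧
          (A.filter fun x => (openGraph (ω ∩ ↑(W.sym2))).Reachable o x).card ≤ j} ≤
      (prodBernoulli w).real {ω : BondConfig (Fin n) |
          1 ≤ (A.filter fun x => (openGraph (ω ∩ ↑(W.sym2))).Reachable o x).card} *
        (prodBernoulli w).real {ω : BondConfig (Fin n) |
          (A.filter fun x => (openGraph (ω ∩ ↑(W.sym2))).Reachable (a i) x).card ≤ j} := by
  refine le_trans (tform_transfer w A W o j V p a i hoA hpV haV hoV hdisj hoW hVW hcover hobs hsep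
    hdead hT hi himax) ?_
  have hup : IsUpperSet {ω : BondConfig (Fin n) |
      1 ≤ (A.filter fun x => (openGraph (ω ∩ ↑(W.sym2))).Reachable o x).card} :=
    fun ω ω' hle h => le_trans h (card_filter_reachable_mono A W o hle)
  have hlow : IsLowerSet {ω : BondConfig (Fin n) |
      (A.filter fun x => (openGraph (ω ∩ ↑(W.sym2))).Reachable (a i) x).card ≤ j} :=
    fun ω ω' hle h => le_trans (card_filter_reachable_mono A W (a i) hle) h
  exact prodBernoulli_harris_upper_lower w hup hlow MeasurableSet.of_discrete MeasurableSet.of_discrete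

/-- **One-block transfer through a single Steiner port.**  If the only positive pair at `o` inside
`insert o V` is `o–p` (`p ∈ V`, relay or not) and the T-form holds at `p` inside `V` with a relay witness
`a ∈ V`, then the T-form holds at `o` inside `insert o V` with the same witness (`tform_transfer` with one
branch). [folklore] -/
theorem tform_port (w : Sym2 (Fin n) → unitInterval) (A V : Finset (Fin n)) (o p a : Fin n) (j : ℕ)
    (hoA : o ∉ A) (hpV : p ∈ V) (haV : a ∈ V) (haA : a ∈ A) (hoV : o ∉ V)
    (hobs : ∀ v ∈ V, v ≠ p → w s(o, v) = 0)
    (hT : (prodBernoulli w).real {ω : BondConfig (Fin n) |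
          1 ≤ (A.filter fun x => (openGraph (ω ∩ ↑(V.sym2))).Reachable p x).card ∧
            (A.filter fun x => (openGraph (ω ∩ ↑(V.sym2))).Reachable p x).card ≤ j} ≤
        (prodBernoulli w).real {ω : BondConfig (Fin n) |
          1 ≤ (A.filter fun x => (openGraph (ω ∩ ↑(V.sym2))).Reachable p x).card ∧
            (A.filter fun x => (openGraph (ω ∩ ↑(V.sym2))).Reachable a x).card ≤ j}) :
    (prodBernoulli w).real {ω : BondConfig (Fin n) |
        1 ≤ (A.filter fun x => (openGraph (ω ∩ ↑((insert o V).sym2))).Reachable o x).card ∧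
          (A.filter fun x => (openGraph (ω ∩ ↑((insert o V).sym2))).Reachable o x).card ≤ j} ≤
      (prodBernoulli w).real {ω : BondConfig (Fin n) |
        1 ≤ (A.filter fun x => (openGraph (ω ∩ ↑((insert o V).sym2))).Reachable o x).card ∧
          (A.filter fun x => (openGraph (ω ∩ ↑((insert o V).sym2))).Reachable a x).card ≤ j} :=
  tform_transfer w A (insert o V) o j (fun _ : Fin 1 => V) (fun _ => p) (fun _ => a) 0 hoA
    (fun _ => hpV) (fun _ => haV) (fun _ => hoV) (fun l l' hll' => absurd (Subsingleton.elim l l') hll')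
    (Finset.mem_insert_self o V) (fun _ => Finset.subset_insert o V)
    (fun _ hv hvo => ⟨0, (Finset.mem_insert.1 hv).resolve_left hvo⟩) (fun _ => hobs)
    (fun l l' hll' => absurd (Subsingleton.elim l l') hll') (fun _ h => absurd haA h) (fun _ _ => hT)
    haA (fun _ _ => le_rfl)

/-- **The cut observer with Steiner ports (whole graph).**  Let `o ∉ A` and let the other vertices be
partitioned into branches `V l` with ports `p l ∈ V l` (relays or not), the only positive pairs at `o`
being the port pairs and no positive pair joining two branches; let `a l ∈ V l` be a relay satisfying the
branch T-form `μ{1 ≤ M_l ≤ j} ≤ μ{1 ≤ M_l ∧ |π_{V l}(a l)| ≤ j}` whenever the branch holds a relay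
(trivial for a relay port, `a l = p l`).  If `A ≠ ∅` then some relay `c` (the best branch witness)
satisfies the T-form `μ{1 ≤ N ≤ j} ≤ μ{1 ≤ N ∧ |π(c)| ≤ j}` in the whole graph. [folklore] -/
theorem tform_cutObserver_steinerPorts (w : Sym2 (Fin n) → unitInterval) (A : Finset (Fin n))
    (o : Fin n) (j : ℕ) {d : ℕ} (V : Fin d → Finset (Fin n)) (p a : Fin d → Fin n)
    (hA : A.Nonempty) (hoA : o ∉ A)
    (hpV : ∀ l, p l ∈ V l) (haV : ∀ l, a l ∈ V l) (hoV : ∀ l, o ∉ V l)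
    (hdisj : ∀ l l', l ≠ l' → Disjoint (V l) (V l'))
    (hcover : ∀ v, v ≠ o → ∃ l, v ∈ V l)
    (hobs : ∀ l, ∀ v ∈ V l, v ≠ p l → w s(o, v) = 0)
    (hsep : ∀ l l', l ≠ l' → ∀ u ∈ V l, ∀ v ∈ V l', w s(u, v) = 0)
    (hdead : ∀ l, a l ∉ A → ∀ x ∈ V l, x ∉ A)
    (hT : ∀ l, a l ∈ A →
      (prodBernoulli w).real {ω : BondConfig (Fin n) |
          1 ≤ (A.filter fun x => (openGraph (ω ∩ ↑((V l).sym2))).Reachable (p l) x).card ∧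
            (A.filter fun x => (openGraph (ω ∩ ↑((V l).sym2))).Reachable (p l) x).card ≤ j} ≤
        (prodBernoulli w).real {ω : BondConfig (Fin n) |
          1 ≤ (A.filter fun x => (openGraph (ω ∩ ↑((V l).sym2))).Reachable (p l) x).card ∧
            (A.filter fun x => (openGraph (ω ∩ ↑((V l).sym2))).Reachable (a l) x).card ≤ j}) :
    ∃ c ∈ A,
      (prodBernoulli w).real {ω : BondConfig (Fin n) |
          1 ≤ (A.filter fun x => ω ∈ openConn o x).card ∧
            (A.filter fun x => ω ∈ openConn o x).card ≤ j} ≤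
        (prodBernoulli w).real {ω : BondConfig (Fin n) |
          1 ≤ (A.filter fun x => ω ∈ openConn o x).card ∧
            (A.filter fun x => ω ∈ openConn c x).card ≤ j} := by
  -- a live branch exists, pick the best one
  obtain ⟨x₀, hx₀⟩ := hA
  obtain ⟨l₀, hl₀⟩ := hcover x₀ fun h => hoA (h ▸ hx₀)
  have hlive₀ : a l₀ ∈ A := by
    by_contra h
    exact hdead l₀ h x₀ hl₀ hx₀
  set tl : Fin d → ℝ := fun l => (prodBernoulli w).real {ω : BondConfig (Fin n) |
    (A.filter fun x => (openGraph (ω ∩ ↑((V l).sym2))).Reachable (a l) x).card ≤ j} with htl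
  obtain ⟨i, hi, himax⟩ := Finset.exists_max_image (Finset.univ.filter fun l => a l ∈ A) tl
    ⟨l₀, Finset.mem_filter.2 ⟨Finset.mem_univ _, hlive₀⟩⟩
  have hiA : a i ∈ A := (Finset.mem_filter.1 hi).2
  refine ⟨a i, hiA, ?_⟩
  have h := tform_transfer w A Finset.univ o j V p a i hoA hpV haV hoV hdisj (Finset.mem_univ o)
    (fun l => Finset.subset_univ _) (fun v _ hv => hcover v hv) hobs hsep hdead hT hiA
    (fun l hl => himax l (Finset.mem_filter.2 ⟨Finset.mem_univ _, hl⟩))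
  have e1 : ∀ (y : Fin n) (ω : BondConfig (Fin n)),
      (A.filter fun x => (openGraph (ω ∩ ↑((Finset.univ : Finset (Fin n)).sym2))).Reachable y x) =
        (A.filter fun x => ω ∈ openConn y x) := fun y ω =>
    Finset.filter_congr fun x _ => by rw [inter_univ_sym2]; exact Iff.rfl
  simp only [e1] at h
  exact h

/-- **CIL for the cut observer with Steiner ports** — the conclusion of the registered stub
`stub_cumulativeIsolation` on this class: `∃ a ∈ A, μ{1 ≤ N ≤ j} ≤ μ{|π(a)| ≤ j}`. [folklore] -/
theorem cumulativeIsolation_cutObserver_steinerPorts (w : Sym2 (Fin n) → unitInterval)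
    (A : Finset (Fin n)) (o : Fin n) (j : ℕ) {d : ℕ} (V : Fin d → Finset (Fin n))
    (p a : Fin d → Fin n) (hA : A.Nonempty) (hoA : o ∉ A)
    (hpV : ∀ l, p l ∈ V l) (haV : ∀ l, a l ∈ V l) (hoV : ∀ l, o ∉ V l)
    (hdisj : ∀ l l', l ≠ l' → Disjoint (V l) (V l'))
    (hcover : ∀ v, v ≠ o → ∃ l, v ∈ V l)
    (hobs : ∀ l, ∀ v ∈ V l, v ≠ p l → w s(o, v) = 0)
    (hsep : ∀ l l', l ≠ l' → ∀ u ∈ V l, ∀ v ∈ V l', w s(u, v) = 0)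
    (hdead : ∀ l, a l ∉ A → ∀ x ∈ V l, x ∉ A)
    (hT : ∀ l, a l ∈ A →
      (prodBernoulli w).real {ω : BondConfig (Fin n) |
          1 ≤ (A.filter fun x => (openGraph (ω ∩ ↑((V l).sym2))).Reachable (p l) x).card ∧
            (A.filter fun x => (openGraph (ω ∩ ↑((V l).sym2))).Reachable (p l) x).card ≤ j} ≤
        (prodBernoulli w).real {ω : BondConfig (Fin n) |
          1 ≤ (A.filter fun x => (openGraph (ω ∩ ↑((V l).sym2))).Reachable (p l) x).card ∧
            (A.filter fun x => (openGraph (ω ∩ ↑((V l).sym2))).Reachable (a l) x).card ≤ j}) :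
    ∃ c ∈ A,
      (prodBernoulli w).real {ω : BondConfig (Fin n) |
          1 ≤ (A.filter fun x => ω ∈ openConn o x).card ∧
            (A.filter fun x => ω ∈ openConn o x).card ≤ j} ≤
        (prodBernoulli w).real {ω : BondConfig (Fin n) |
          (A.filter fun x => ω ∈ openConn c x).card ≤ j} := by
  obtain ⟨c, hc, h⟩ := tform_cutObserver_steinerPorts w A o j V p a hA hoA hpV haV hoV hdisj hcover
    hobs hsep hdead hT
  exact ⟨c, hc, le_trans h (measureReal_mono (fun ω hω => hω.2) (measure_ne_top _ _))⟩

/-- **T-form for the cut observer with RELAY ports** (strengthening of the conclusion of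
`Theorems.cumulativeIsolation_cutObserver` to the guarded form): if every port `p l` is a relay, then
some relay `c` has `μ{1 ≤ N ≤ j} ≤ μ{1 ≤ N ∧ |π(c)| ≤ j}`; the branch hypotheses are vacuous
(`a l = p l`). [folklore] -/
theorem tform_cutObserver_relayPorts (w : Sym2 (Fin n) → unitInterval) (A : Finset (Fin n))
    (o : Fin n) (j : ℕ) {d : ℕ} (V : Fin d → Finset (Fin n)) (p : Fin d → Fin n)
    (hA : A.Nonempty) (hoA : o ∉ A) (hpV : ∀ l, p l ∈ V l) (hpA : ∀ l, p l ∈ A) (hoV : ∀ l, o ∉ V l)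
    (hdisj : ∀ l l', l ≠ l' → Disjoint (V l) (V l'))
    (hcover : ∀ v, v ≠ o → ∃ l, v ∈ V l)
    (hobs : ∀ l, ∀ v ∈ V l, v ≠ p l → w s(o, v) = 0)
    (hsep : ∀ l l', l ≠ l' → ∀ u ∈ V l, ∀ v ∈ V l', w s(u, v) = 0) :
    ∃ c ∈ A,
      (prodBernoulli w).real {ω : BondConfig (Fin n) |
          1 ≤ (A.filter fun x => ω ∈ openConn o x).card ∧
            (A.filter fun x => ω ∈ openConn o x).card ≤ j} ≤
        (prodBernoulli w).real {ω : BondConfig (Fin n) |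
          1 ≤ (A.filter fun x => ω ∈ openConn o x).card ∧
            (A.filter fun x => ω ∈ openConn c x).card ≤ j} :=
  tform_cutObserver_steinerPorts w A o j V p p hA hoA hpV hpV hoV hdisj hcover hobs hsep
    (fun l hl => absurd (hpA l) hl) (fun _ _ => le_rfl)

end SteinerPorts

end CutObserver

end Summit.CriticalPhenomena.PercolationContinuityZ3.Theorems

end
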